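import Literature.Computability.Complexity.ExtMonotoneGates
import Mathlib

/-!
# Wideness is free, PERM side: the `∧`-padding of a PERM gate is a PERM gate
(stub `isPermGate_andPad` of the line `width-threshold-certificate-sparsity`,
crux `ConvexRankGates.CliqueExtLowerBound`, stmt-PneNP-10682; reshape r8 of lead c12)

The reshape r8 removes the side condition "not narrow" of the r7 leaves by PADDING a gate `φ` of
fan-in `n` with `n'` dummy wires under a conjunction,
  `⟨n + n', v ↦ φ (v ∘ Fin.castAdd n') && [∀ j, v (Fin.natAdd n j)]⟩`
(written inline, no definition is introduced). This file proves that the padded gate of a PERM gate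
on `d ≤ s` points is again a PERM gate, on `d + 2n' ≤ s + 2n'` points (`isPermGate_andPad`):

* points: the old `d` points together with `2n'` fresh ones, two per dummy, `(j, 0)` and `(j, 1)`;
* generators: an old wire `i` acts by the old `σ i` on the old points and fixes the fresh ones; the
  dummy `j` is the transposition of its two fresh points;
* target: the old target `τ` on the old points times the product `π` of all dummy transpositions.

The presentation lives in the product group `Perm (Fin d) × Perm (Fin n' × Fin 2)`, embedded in the
symmetric group of `Fin d ⊕ Fin n' × Fin 2` by `Equiv.Perm.sumCongrHom` and conjugated onto
`Fin (d + 2n')` (`isPermGate_of_embedding`: closures commute with homomorphisms and membership is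
reflected by injective ones). In a product group the subgroup generated by `A × 1 ∪ 1 × B` is the
product of the generated subgroups (`closure_inl_union_inr`), so the padded gate accepts iff `τ` lies in
the old closure AND `π` lies in the subgroup generated by the transpositions of the dummies that are on;
the latter happens iff every dummy is on (`dummyBlock`: a missing transposition's point `(j, 0)` is fixed
by all the other generators, hence by the closure, but `π` moves it).
-/

set_option linter.dupNamespace false

open Literature.Computability.Complexity Finset

namespace Summit.PneNP.PneNP.Theorems.CliqueExtLowerBound.WidthThreshold.PermAndPad

/-! ## §1 Three group-theoretic helpers -/

/-- Transport. A gate presented by group elements `σ i`, `τ` of a group `G` that embeds into the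
symmetric group of a finite set `α` of `≤ s` points is a PERM gate of width `s`: push the presentation
through the embedding and conjugate by `Fintype.equivFin α`; the closure of the image is the image of
the closure (`MonoidHom.map_closure`) and an injective homomorphism reflects membership
(`Subgroup.mem_map_iff_mem`). [folklore] -/
private theorem isPermGate_of_embedding {α G : Type*} [Fintype α] [Group G] (s : ℕ) (g : GateFn)
    (hα : Fintype.card α ≤ s) (F : G →* Equiv.Perm α) (hF : Function.Injective F)
    (σ : Fin g.1 → G) (τ : G)
    (h : ∀ v : Fin g.1 → Bool, g.2 v = true ↔ τ ∈ Subgroup.closure (σ '' {i | v i = true})) :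
    IsPermGate s g := by
  classical
  have hinj : Function.Injective ((Fintype.equivFin α).permCongrHom.toMonoidHom.comp F) :=
    (Fintype.equivFin α).permCongrHom.injective.comp hF
  refine ⟨Fintype.card α, hα, ⇑((Fintype.equivFin α).permCongrHom.toMonoidHom.comp F) ∘ σ,
    (Fintype.equivFin α).permCongrHom.toMonoidHom.comp F τ, fun v => ?_⟩
  rw [h v, Set.image_comp, ← MonoidHom.map_closure, Subgroup.mem_map_iff_mem hinj]

/-- In a product of groups, the subgroup generated by `A × 1 ∪ 1 × B` is the product of the subgroup
generated by `A` and the subgroup generated by `B`. [folklore] -/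
private theorem closure_inl_union_inr {G N : Type*} [Group G] [Group N] (A : Set G) (B : Set N) :
    Subgroup.closure (MonoidHom.inl G N '' A ∪ MonoidHom.inr G N '' B) =
      (Subgroup.closure A).prod (Subgroup.closure B) := by
  refine le_antisymm ((Subgroup.closure_le _).2 ?_) (Subgroup.prod_le_iff.2 ⟨?_, ?_⟩)
  · rintro p (⟨a, ha, rfl⟩ | ⟨b, hb, rfl⟩)
    · exact Subgroup.mem_prod.2 ⟨Subgroup.subset_closure ha, by simp⟩
    · exact Subgroup.mem_prod.2 ⟨by simp, Subgroup.subset_closure hb⟩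
  · rw [MonoidHom.map_closure]
    exact Subgroup.closure_mono Set.subset_union_left
  · rw [MonoidHom.map_closure]
    exact Subgroup.closure_mono Set.subset_union_right

/-- Splitting the on-wires of a padded assignment: the image of `{k | v k}` under an appended family
`Fin.append (inl ∘ a) (inr ∘ b)` is `inl '' (a '' {old on-wires}) ∪ inr '' (b '' {dummy on-wires})`, so
that by `closure_inl_union_inr` a pair lies in the generated subgroup iff each component lies in the
subgroup generated by its own block. [folklore] -/
private theorem mem_closure_append_iff {G N : Type*} [Group G] [Group N] {m n : ℕ} (a : Fin m → G)
    (b : Fin n → N) (v : Fin (m + n) → Bool) (x : G) (y : N) :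
    (x, y) ∈ Subgroup.closure (Fin.append (fun i => MonoidHom.inl G N (a i))
        (fun j => MonoidHom.inr G N (b j)) '' {k | v k = true}) ↔
      x ∈ Subgroup.closure (a '' {i | v (Fin.castAdd n i) = true}) ∧
        y ∈ Subgroup.closure (b '' {j | v (Fin.natAdd m j) = true}) := by
  have hsplit : Fin.append (fun i => MonoidHom.inl G N (a i)) (fun j => MonoidHom.inr G N (b j)) ''
      {k | v k = true} = MonoidHom.inl G N '' (a '' {i | v (Fin.castAdd n i) = true}) ∪
        MonoidHom.inr G N '' (b '' {j | v (Fin.natAdd m j) = true}) := by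
    ext p
    constructor
    · rintro ⟨k, hk, rfl⟩
      induction k using Fin.addCases with
      | left i => exact Set.mem_union_left _ ⟨a i, ⟨i, hk, rfl⟩, by simp⟩
      | right j => exact Set.mem_union_right _ ⟨b j, ⟨j, hk, rfl⟩, by simp⟩
    · rintro (⟨_, ⟨i, hi, rfl⟩, rfl⟩ | ⟨_, ⟨j, hj, rfl⟩, rfl⟩)
      · exact ⟨Fin.castAdd n i, hi, by simp⟩
      · exact ⟨Fin.natAdd m j, hj, by simp⟩
  rw [hsplit, closure_inl_union_inr, Subgroup.mem_prod]

/-- The dummy block. On the `2n'` points `Fin n' × Fin 2` let dummy `j` act by the transposition of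
`(j, 0)` and `(j, 1)` (`Equiv.Perm.prodExtendRight j (swap 0 1)`) and let `π` swap `(j, 0)` and `(j, 1)`
for every `j` (`Equiv.prodCongrRight`). Then `π` lies in the subgroup generated by the transpositions
indexed by `J` iff `J` is everything: `⇐` because `π` is the product of all the transpositions
(`Equiv.Perm.prod_prodExtendRight`); `⇒` because for `j ∉ J` every generator fixes `(j, 0)`, hence so
does the generated subgroup (it lies in the stabiliser), whereas `π (j, 0) = (j, 1)`. [folklore] -/
private theorem dummyBlock (n' : ℕ) : ∃ (sw : Fin n' → Equiv.Perm (Fin n' × Fin 2))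
    (π : Equiv.Perm (Fin n' × Fin 2)),
      ∀ J : Set (Fin n'), π ∈ Subgroup.closure (sw '' J) ↔ ∀ j, j ∈ J := by
  refine ⟨fun j => Equiv.Perm.prodExtendRight j (Equiv.swap (0 : Fin 2) 1),
    Equiv.prodCongrRight fun _ : Fin n' => Equiv.swap (0 : Fin 2) 1, fun J => ⟨fun h j => ?_, fun h => ?_⟩⟩
  · by_contra hj
    have hle : Subgroup.closure
        ((fun j : Fin n' => Equiv.Perm.prodExtendRight j (Equiv.swap (0 : Fin 2) 1)) '' J) ≤
          MulAction.stabilizer (Equiv.Perm (Fin n' × Fin 2)) ((j, 0) : Fin n' × Fin 2) := by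
      refine (Subgroup.closure_le _).2 ?_
      rintro _ ⟨a, ha, rfl⟩
      have hja : j ≠ a := fun e => hj (e ▸ ha)
      simp only [SetLike.mem_coe, MulAction.mem_stabilizer_iff, Equiv.Perm.smul_def]
      exact Equiv.Perm.prodExtendRight_apply_ne _ hja _
    have hfix := MulAction.mem_stabilizer_iff.1 (hle h)
    rw [Equiv.Perm.smul_def, Equiv.prodCongrRight_apply, Equiv.swap_apply_left] at hfix
    exact absurd (congrArg Prod.snd hfix) (by decide : (1 : Fin 2) ≠ 0)
  · rw [← Equiv.Perm.prod_prodExtendRight (fun _ : Fin n' => Equiv.swap (0 : Fin 2) 1)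
      (List.nodup_finRange n') (fun a => List.mem_finRange a)]
    refine Subgroup.list_prod_mem _ (fun g hg => ?_)
    obtain ⟨a, -, rfl⟩ := List.mem_map.1 hg
    exact Subgroup.subset_closure ⟨a, h a, rfl⟩

/-! ## §2 The registered sub-goal -/

/-- REGISTERED SUB-GOAL `isPermGate_andPad` (line `width-threshold-certificate-sparsity`, reshape r8,
wave 2). The `∧`-padding of a PERM gate on `d ≤ s` points by `n'` dummy wires is a PERM gate on
`≤ s + 2n'` points: old generators act on the old points (identity on the new ones), dummy `j` is the
transposition of its two new points, the target is `τ` times the product of all dummy transpositions;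
the closure of such a union is the direct product of the closures (`mem_closure_append_iff`), and the
product of the disjoint transpositions lies in the closure of a subfamily iff the subfamily is
everything (`dummyBlock`). [folklore] -/
theorem isPermGate_andPad : ∀ (s n' : ℕ) (φ : GateFn), IsPermGate s φ →
    IsPermGate (s + 2 * n') ⟨φ.1 + n', fun v => φ.2 (fun i => v (Fin.castAdd n' i)) &&
        decide (∀ j : Fin n', v (Fin.natAdd φ.1 j) = true)⟩ := by
  rintro s n' φ ⟨d, hd, σ, τ, hiff⟩
  obtain ⟨sw, π, hπ⟩ := dummyBlock n'
  refine isPermGate_of_embedding (α := Fin d ⊕ Fin n' × Fin 2) (s + 2 * n') _ ?_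
    (Equiv.Perm.sumCongrHom (Fin d) (Fin n' × Fin 2)) Equiv.Perm.sumCongrHom_injective
    (Fin.append (m := φ.1) (n := n') (fun i => MonoidHom.inl _ _ (σ i)) (fun j => MonoidHom.inr _ _ (sw j)))
    (τ, π)
    fun v => ?_
  · simp only [Fintype.card_sum, Fintype.card_prod, Fintype.card_fin]
    omega
  · rw [mem_closure_append_iff, ← hiff, hπ]
    simp [Bool.and_eq_true]

end Summit.PneNP.PneNP.Theorems.CliqueExtLowerBound.WidthThreshold.PermAndPad
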